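import Summits.Parity.GeneralizedHardyLittlewood.Theorems.PrimeLevelFamEdgeMomentsBeyondDiagonalDiagLines
import Summits.Parity.GeneralizedHardyLittlewood.Theorems.PrimeLevelFamEdgeMomentsBeyondDiagonalDictionaryAtOneTruncation
import Summits.Parity.GeneralizedHardyLittlewood.Theorems.PrimeLevelFamEdgeMomentsBeyondDiagonalDictionaryAtOneOffBoxWeight
import HarnessLib

/-!
# Route `PrimeLevelFamEdge`, crux K_A `MomentsBeyondDiagonal` (stmt-Parity-20007), line «petersson_layers» v4,
# registered stub `stub_diag : SubDiag` — THE DIAGONAL PART AT `Q = 1` IS K_B's TRUE DIAGONAL KERNEL (box-exact)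

The `Q = 1` slice of `stub_diag` meets the EVALUATED kernel of crux K_B (stmt-Parity-20343, line `diagonal_kernel_split`): there the
Petersson diagonal of the AFE ⊗ Hecke expansion of the mollified second moment was summed over ALL `(n₁, n₂) ∈ ℕ²` into the true
diagonal kernel `K_true(q̂; a, b) = (ab)⁻¹ Σ_{c∣(a,b)} c τ((a/c)(b/c)) 𝒲((a/c)(b/c)/q̂²)` (`PeterssonSplit.tsum_afeWeight_diagCount`,
`Corner.trueDiagKernel`), and for the profile `P = X²` its quadratic form was EVALUATED beyond the diagonal:
`Σ x x K_true = 4ζ(2)²(1/Δ' + 1)/(Δ'² log² q̂) + O(log⁻³)` on `1 < Δ' < 2` (`KernelFormXSq.kernelForm_xsq_asymp` + `Corner.abs_corner_le`).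
Deck 21a's `diagPart` keeps the AFE box `nᵢ ≤ q²`. This file (helper, identities + one elementary bound):

* §1 `diagPart_one_eq_sum_afeWeight_diagCount` — for every `P`:
  `diagPart q P 1 Δ' = 2q̂ Σ_{m₁,m₂ ≤ M} x_{m₁}x_{m₂} Σ_{n₁,n₂ ≤ q²} w_q(n₁,n₂) · diagCount m₁ m₂ (n₁,n₂)`
  (`w_q = PeterssonSplit.afeWeight`, `diagCount` = K_B's Hecke–Petersson diagonal count).
* §2 `sum_box_add_tsum_offBox_eq` — box + off-box = K_B's full series:
  `Σ_{box²} w·diagCount a b + Σ'_{ℕ² ∖ box²} w·diagCount a b = (ab)^{1/2} K_true(q̂; a, b)`;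
  `tsum_offBox_diagCount_le` — the off-box part is `0 ≤ · ≤ τ(a)τ(b) · Σ'_{ℕ² ∖ box²} w_q`.
* §3 `tsum_offBox_afeWeight_le` — `Σ'_{ℕ² ∖ box²} w_q ≤ 92160·12!·q̂⁶q⁻⁶·Σ'_{ℕ²} n₁^{−5/2}n₂^{−5/2}` (super-polynomially irrelevant:
  the off-box weight `(n₁n₂)^{−1/2}W(n₁n₂/q̂²)` with `n₁n₂ > q² = 16π⁴q̂⁴`; deck lemma `weight_offBox_le`).

So at `Q = 1`: `diagPart q P 1 Δ' = 2q̂ Σ x_{m₁}x_{m₂} (m₁m₂)^{1/2} K_true(q̂;m₁,m₂) − (off-box)`, and with `mollifierCoeff X² = xsq·m^{−1/2}`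
(`PeterssonSplit.mollifierCoeff_X_sq`) the first term at `P = X²` is EXACTLY `2q̂ ×` K_B's evaluated form `Σ xsq xsq K_true`. What remains
for «`SubDiag` at `(P,Q) = (X², 1)`» is bookkeeping: K_B's two asymptotics at `Q = q̂`, `M = q̂^{Δ'}`, `L = log q̂` (`Δ' ≤ 3/2 < 2`),
`secondMomentForm Δ' X² 1 = 4 + 4/Δ'` (`KMV2000.secondMomentForm_X_sq_one`), and §2–§3 for the box. NOT done here.
Helper `--supports stmt-Parity-20007`; closes nothing; K_A, K_B and the Parity summit are NOT proved; nothing about Landau–Siegel zeros.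
-/

noncomputable section

open scoped Real Nat
open Complex Finset Polynomial
open Literature.NumberTheory.LFunctions

namespace Summit.Parity.GeneralizedHardyLittlewood.Theorems.MomentsBeyondDiagonal.DiagLines

open Summit.Parity.GeneralizedHardyLittlewood.Theorems.PrimeLevelFamEdgeIdeaDeltas.PeterssonLayers
  (spectralSum afeBox diagKernel diagPart afeW_eq_kmv spectralSum_one afeW_zero_zero ne_zero_of_mem_afeBox weight_offBox_le
    summable_prod_rpow)
open Summit.Parity.GeneralizedHardyLittlewood.Theorems.BeyondDiagonalBeatsQuarter
open Summit.Parity.GeneralizedHardyLittlewood.Theorems.BeyondDiagonalBeatsQuarter.PeterssonSplit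
  (afeWeight diagCount diagCount_eq_sum diagCount_le hasSum_afeWeight_diagCount summable_afeWeight afeWeight_nonneg)

/-! ## §1. `diagPart` at `Q = 1` through K_B's `afeWeight · diagCount` -/

/-- The Hecke–Petersson diagonal count of deck 21a's kernel `δ` IS K_B's `diagCount` (as a complex number):
`Σ_{d₁∣(a,n₁)} Σ_{d₂∣(b,n₂)} δ(a n₁/d₁², b n₂/d₂²) = diagCount a b (n₁,n₂)` (`a, b ≠ 0`).
[cite: KowalskiMichelVanderKam2000, (21)–(23) p. 12–13 — derivation] -/
theorem sum_gcd_divisors_diagKernel_eq_diagCount {a b : ℕ} (ha : a ≠ 0) (hb : b ≠ 0) (n₁ n₂ : ℕ) :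
    ∑ d₁ ∈ (a.gcd n₁).divisors, ∑ d₂ ∈ (b.gcd n₂).divisors, diagKernel (a * n₁ / d₁ ^ 2) (b * n₂ / d₂ ^ 2) =
      ((diagCount a b (n₁, n₂) : ℝ) : ℂ) := by
  rw [sum_gcd_divisors_diagKernel_eq ha hb, diagCount_eq_sum ha hb, Complex.ofReal_sum, Finset.sum_product]
  refine Finset.sum_congr rfl fun d₁ _ ↦ Finset.sum_congr rfl fun d₂ _ ↦ ?_
  split_ifs <;> simp

/-- **§1. `diagPart` at `Q = 1` in K_B's vocabulary.** For every level `q`, profile `P` and `Δ'` (`M = q̂^{Δ'}`):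
`diagPart q P 1 Δ' = 2q̂ Σ_{m₁,m₂ ≤ M} x_{m₁}x_{m₂} Σ_{n₁,n₂ ∈ [1,q²]} w_q(n₁,n₂)·diagCount m₁ m₂ (n₁,n₂)`,
`w_q(n₁,n₂) = (n₁n₂)^{−1/2}W(n₁n₂/q̂²) = PeterssonSplit.afeWeight q (n₁,n₂)` (the `i = j = 0` slice `spectralSum_one`, `W₀₀ = W`
in the box, and `sum_gcd_divisors_diagKernel_eq_diagCount`). [cite: KowalskiMichelVanderKam2000, (21)–(23) p. 12–13 — derivation] -/
theorem diagPart_one_eq_sum_afeWeight_diagCount (q : ℕ) [NeZero q] (P : ℝ[X]) (Δ' : ℝ) :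
    diagPart q P 1 Δ' = 2 * (KMV2000.qhat q : ℂ) *
      ∑ m₁ ∈ Icc 1 ⌊KMV2000.qhat q ^ Δ'⌋₊, ∑ m₂ ∈ Icc 1 ⌊KMV2000.qhat q ^ Δ'⌋₊,
        (KMV2000.mollifierCoeff P (KMV2000.qhat q ^ Δ') m₁ : ℂ) * (KMV2000.mollifierCoeff P (KMV2000.qhat q ^ Δ') m₂ : ℂ) *
        ∑ n₁ ∈ afeBox q, ∑ n₂ ∈ afeBox q,
          (((afeWeight q (n₁, n₂) * (diagCount m₁ m₂ (n₁, n₂) : ℝ)) : ℝ) : ℂ) := by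
  unfold diagPart
  rw [spectralSum_one]
  congr 1
  rw [sum_sum_mul_sum_sum_comm]
  refine Finset.sum_congr rfl fun m₁ hm₁ ↦ Finset.sum_congr rfl fun m₂ hm₂ ↦ ?_
  have hm₁0 : m₁ ≠ 0 := by have := (Finset.mem_Icc.mp hm₁).1; omega
  have hm₂0 : m₂ ≠ 0 := by have := (Finset.mem_Icc.mp hm₂).1; omega
  congr 1
  refine Finset.sum_congr rfl fun n₁ hn₁ ↦ Finset.sum_congr rfl fun n₂ hn₂ ↦ ?_
  rw [afeW_zero_zero q (ne_zero_of_mem_afeBox hn₁) (ne_zero_of_mem_afeBox hn₂),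
    sum_gcd_divisors_diagKernel_eq_diagCount hm₁0 hm₂0]
  simp only [afeWeight]
  push_cast
  ring

/-! ## §2. Box + off-box = K_B's full series; the off-box part is small in `τ` -/

/-- **§2. Box + off-box = the true diagonal kernel.** For `q ≥ 1`, `a, b ≠ 0`:
`Σ_{n₁,n₂ ∈ [1,q²]} w_q·diagCount a b + Σ'_{(n₁,n₂) ∉ [1,q²]²} w_q·diagCount a b = (ab)^{1/2}·K_true(q̂; a, b)`
(`PeterssonSplit.hasSum_afeWeight_diagCount` split along the AFE box). [cite: KowalskiMichelVanderKam2000, (21)–(23) p. 12–13 — derivation] -/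
theorem sum_box_add_tsum_offBox_eq {q : ℕ} (hq : 1 ≤ q) {a b : ℕ} (ha : a ≠ 0) (hb : b ≠ 0) :
    ∑ n₁ ∈ afeBox q, ∑ n₂ ∈ afeBox q, afeWeight q (n₁, n₂) * (diagCount a b (n₁, n₂) : ℝ) +
      ∑' n : ↑((afeBox q ×ˢ afeBox q : Finset (ℕ × ℕ)) : Set (ℕ × ℕ))ᶜ, afeWeight q n * (diagCount a b n : ℝ) =
      ((a : ℝ) * b) ^ (1 / 2 : ℝ) * Corner.trueDiagKernel (KMV2000.qhat q) a b := by
  have h := hasSum_afeWeight_diagCount hq ha hb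
  rw [← h.tsum_eq, ← h.summable.sum_add_tsum_compl (s := afeBox q ×ˢ afeBox q), Finset.sum_product]

/-- The off-box part of a pair is non-negative. -/
theorem tsum_offBox_diagCount_nonneg (q a b : ℕ) :
    0 ≤ ∑' n : ↑((afeBox q ×ˢ afeBox q : Finset (ℕ × ℕ)) : Set (ℕ × ℕ))ᶜ, afeWeight q n * (diagCount a b n : ℝ) :=
  tsum_nonneg fun n ↦ mul_nonneg (afeWeight_nonneg q n) (Nat.cast_nonneg _)

/-- **§2. The off-box part of a pair is at most `τ(a)τ(b)` times the off-box AFE weight**: for `q ≥ 1`, `a, b ≠ 0`,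
`Σ'_{n ∉ box²} w_q(n)·diagCount a b n ≤ τ(a)τ(b) · Σ'_{n ∉ box²} w_q(n)` (`diagCount ≤ τ(a)τ(b)`). [folklore] -/
theorem tsum_offBox_diagCount_le {q : ℕ} (hq : 1 ≤ q) {a b : ℕ} (ha : a ≠ 0) (hb : b ≠ 0) :
    ∑' n : ↑((afeBox q ×ˢ afeBox q : Finset (ℕ × ℕ)) : Set (ℕ × ℕ))ᶜ, afeWeight q n * (diagCount a b n : ℝ) ≤
      ((a.divisors.card * b.divisors.card : ℕ) : ℝ) *
        ∑' n : ↑((afeBox q ×ˢ afeBox q : Finset (ℕ × ℕ)) : Set (ℕ × ℕ))ᶜ, afeWeight q n := by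
  have hsw : Summable fun n : ↑((afeBox q ×ˢ afeBox q : Finset (ℕ × ℕ)) : Set (ℕ × ℕ))ᶜ ↦ afeWeight q n :=
    (summable_afeWeight hq).subtype _
  have hle : ∀ n : ↑((afeBox q ×ˢ afeBox q : Finset (ℕ × ℕ)) : Set (ℕ × ℕ))ᶜ,
      afeWeight q n * (diagCount a b n : ℝ) ≤ ((a.divisors.card * b.divisors.card : ℕ) : ℝ) * afeWeight q n := by
    intro n
    rw [mul_comm]
    exact mul_le_mul_of_nonneg_right (by exact_mod_cast diagCount_le ha hb n) (afeWeight_nonneg q n)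
  have hs : Summable fun n : ↑((afeBox q ×ˢ afeBox q : Finset (ℕ × ℕ)) : Set (ℕ × ℕ))ᶜ ↦
      afeWeight q n * (diagCount a b n : ℝ) :=
    Summable.of_nonneg_of_le (fun n ↦ mul_nonneg (afeWeight_nonneg q n) (Nat.cast_nonneg _)) hle (hsw.mul_left _)
  rw [← tsum_mul_left]
  exact hs.tsum_le_tsum hle (hsw.mul_left _)

/-! ## §3. The off-box AFE weight is super-polynomially small -/

/-- **§3. The total off-box AFE weight**: for `q ≥ 1`,
`Σ'_{(n₁,n₂) ∉ [1,q²]²} (n₁n₂)^{−1/2} W(n₁n₂/q̂²) ≤ 92160·12!·q̂⁶·q⁻⁶ · Σ'_{(n₁,n₂) ∈ ℕ²} n₁^{−5/2} n₂^{−5/2}`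
(off the box `n₁n₂ > q² = 16π⁴q̂⁴`, so `W(n₁n₂/q̂²) ≤ 2·6!·2⁶ e^{−π√q}(…)`; deck lemma `weight_offBox_le`). With `q̂² = q/4π²` the
right-hand side is `≪ q⁻³`. [cite: KowalskiMichelVanderKam2000, (22) p. 12 — derivation] -/
theorem tsum_offBox_afeWeight_le {q : ℕ} [NeZero q] (hq : 1 ≤ q) :
    ∑' n : ↑((afeBox q ×ˢ afeBox q : Finset (ℕ × ℕ)) : Set (ℕ × ℕ))ᶜ, afeWeight q n ≤
      92160 * (12 ! : ℝ) * KMV2000.qhat q ^ (6 : ℝ) * ((q : ℝ)) ^ (-(6 : ℝ)) *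
        ∑' n : ℕ × ℕ, ((n.1 : ℝ)) ^ (-(5 / 2 : ℝ)) * ((n.2 : ℝ)) ^ (-(5 / 2 : ℝ)) := by
  set c : ℝ := 92160 * (12 ! : ℝ) * KMV2000.qhat q ^ (6 : ℝ) * ((q : ℝ)) ^ (-(6 : ℝ)) with hc
  have hc0 : 0 ≤ c := by
    have := (KMV2000.qhat_pos_of_neZero q).le
    positivity
  set g : ℕ × ℕ → ℝ := fun n ↦ ((n.1 : ℝ)) ^ (-(5 / 2 : ℝ)) * ((n.2 : ℝ)) ^ (-(5 / 2 : ℝ)) with hg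
  have hg0 : ∀ n, 0 ≤ g n := fun n ↦ mul_nonneg (Real.rpow_nonneg (Nat.cast_nonneg _) _) (Real.rpow_nonneg (Nat.cast_nonneg _) _)
  have hgs : Summable g := summable_prod_rpow (by norm_num)
  -- pointwise, off the box: `w_q(n) ≤ c · g n`
  have hptw : ∀ n : ↑((afeBox q ×ˢ afeBox q : Finset (ℕ × ℕ)) : Set (ℕ × ℕ))ᶜ, afeWeight q n ≤ c * g n := by
    rintro ⟨⟨n₁, n₂⟩, hn⟩
    have hn : ¬ ((n₁, n₂) ∈ afeBox q ×ˢ afeBox q) := by simpa using hn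
    simp only [Finset.mem_product, afeBox, Finset.mem_Icc, not_and_or, not_le] at hn
    by_cases h₁ : n₁ = 0
    · subst h₁
      have : afeWeight q (0, n₂) = 0 := by simp [afeWeight]
      rw [this]; exact mul_nonneg hc0 (hg0 _)
    by_cases h₂ : n₂ = 0
    · subst h₂
      have : afeWeight q (n₁, 0) = 0 := by simp [afeWeight]
      rw [this]; exact mul_nonneg hc0 (hg0 _)
    have hn₁ : 1 ≤ n₁ := Nat.one_le_iff_ne_zero.mpr h₁
    have hn₂ : 1 ≤ n₂ := Nat.one_le_iff_ne_zero.mpr h₂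
    have hout : ((q : ℝ)) ^ 2 ≤ (n₁ : ℝ) * n₂ := by
      have hbig : q ^ 2 < n₁ * n₂ := by
        rcases hn with (h | h) | (h | h)
        · omega
        · calc q ^ 2 < n₁ := h
            _ ≤ n₁ * n₂ := Nat.le_mul_of_pos_right _ (by omega)
        · omega
        · calc q ^ 2 < n₂ := h
            _ ≤ n₁ * n₂ := Nat.le_mul_of_pos_left _ (by omega)
      exact_mod_cast hbig.le
    have hw := weight_offBox_le (q := q) h₁ h₂ hout
    have hN1 : (1 : ℝ) ≤ (n₁ : ℝ) * n₂ := by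
      have : (1 : ℝ) ≤ n₁ := by exact_mod_cast hn₁
      have : (1 : ℝ) ≤ n₂ := by exact_mod_cast hn₂
      nlinarith
    calc afeWeight q (n₁, n₂) ≤ afeWeight q (n₁, n₂) * (((n₁ : ℝ) * n₂) ^ (1 : ℝ)) := by
          rw [Real.rpow_one]
          exact le_mul_of_one_le_right (afeWeight_nonneg q _) hN1
      _ ≤ c * g (n₁, n₂) := by simpa [afeWeight, hc, hg] using hw
  have hsw : Summable fun n : ↑((afeBox q ×ˢ afeBox q : Finset (ℕ × ℕ)) : Set (ℕ × ℕ))ᶜ ↦ afeWeight q n :=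
    (summable_afeWeight hq).subtype _
  have hgs' : Summable fun n : ↑((afeBox q ×ˢ afeBox q : Finset (ℕ × ℕ)) : Set (ℕ × ℕ))ᶜ ↦ c * g n :=
    (hgs.mul_left c).subtype _
  calc ∑' n : ↑((afeBox q ×ˢ afeBox q : Finset (ℕ × ℕ)) : Set (ℕ × ℕ))ᶜ, afeWeight q n
      ≤ ∑' n : ↑((afeBox q ×ˢ afeBox q : Finset (ℕ × ℕ)) : Set (ℕ × ℕ))ᶜ, c * g n := hsw.tsum_le_tsum hptw hgs'
    _ ≤ ∑' n : ℕ × ℕ, c * g n :=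
        (hgs.mul_left c).tsum_subtype_le (fun n : ℕ × ℕ ↦ c * g n) _ (fun n ↦ mul_nonneg hc0 (hg0 n))
    _ = c * ∑' n : ℕ × ℕ, g n := tsum_mul_left

/-- **`diagPart` at `Q = 1` = K_B's evaluated form minus the off-box remainder (real form).** For `q ≥ 1`, every `P`, `Δ'`:
`diagPart q P 1 Δ' = 2q̂ Σ_{m₁,m₂ ≤ M} x_{m₁}x_{m₂} ( (m₁m₂)^{1/2} K_true(q̂;m₁,m₂) − Σ'_{n ∉ box²} w_q(n) diagCount m₁ m₂ n )`.
At `P = X²`, `x_m = xsq M m · m^{−1/2}` and the first term is `2q̂ Σ xsq xsq K_true` of `KernelFormXSq` / `CornerNegligibleXSq`.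
[cite: KowalskiMichelVanderKam2000, (21)–(23) p. 12–13 and Prop. 5.1 — derivation] -/
theorem diagPart_one_eq_trueDiagKernel_sub_offBox {q : ℕ} [NeZero q] (hq : 1 ≤ q) (P : ℝ[X]) (Δ' : ℝ) :
    diagPart q P 1 Δ' = (((2 * KMV2000.qhat q *
      ∑ m₁ ∈ Icc 1 ⌊KMV2000.qhat q ^ Δ'⌋₊, ∑ m₂ ∈ Icc 1 ⌊KMV2000.qhat q ^ Δ'⌋₊,
        KMV2000.mollifierCoeff P (KMV2000.qhat q ^ Δ') m₁ * KMV2000.mollifierCoeff P (KMV2000.qhat q ^ Δ') m₂ *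
        ((((m₁ : ℝ) * m₂) ^ (1 / 2 : ℝ) * Corner.trueDiagKernel (KMV2000.qhat q) m₁ m₂) -
          ∑' n : ↑((afeBox q ×ˢ afeBox q : Finset (ℕ × ℕ)) : Set (ℕ × ℕ))ᶜ, afeWeight q n * (diagCount m₁ m₂ n : ℝ)) : ℝ)) : ℂ) := by
  rw [diagPart_one_eq_sum_afeWeight_diagCount]
  push_cast
  congr 1
  refine Finset.sum_congr rfl fun m₁ hm₁ ↦ Finset.sum_congr rfl fun m₂ hm₂ ↦ ?_
  have hm₁0 : m₁ ≠ 0 := by have := (Finset.mem_Icc.mp hm₁).1; omega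
  have hm₂0 : m₂ ≠ 0 := by have := (Finset.mem_Icc.mp hm₂).1; omega
  congr 1
  have h := sum_box_add_tsum_offBox_eq hq hm₁0 hm₂0
  rw [← eq_sub_iff_add_eq] at h
  have h' := congrArg (fun r : ℝ ↦ (r : ℂ)) h
  push_cast [Complex.ofReal_tsum] at h' ⊢
  linear_combination h'

end Summit.Parity.GeneralizedHardyLittlewood.Theorems.MomentsBeyondDiagonal.DiagLines

end
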